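import Summits.QuantumFields.YangMills.Theorems.IR.Negative.TypShellCondFalseAllG.Geometry

/-!
# Crux `IR` (stmt-QuantumFields-19354) — the fixed-mesh negative for format T and the onset floor FOR EVERY COMPACT
# GAUGE GROUP, part 3/8: §7 the layer comb and the flatness of the twisted datum (section `Comb`)

Re-homed VERBATIM (statements, proofs, names; namespace `…Cruxes.IR.CruxIdea2g6` ↦ `…Cruxes.IR.FixedMeshAllG`) from the crux
workfile `Cruxes/IR/CruxIdea2FrameRowAllG.lean` rev 2 (sha16 81bea4c546c46a61; author `ym-cruxidea-19354-2` GEN 6) per owner R88,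
split by its sections into eight ≤ 400-line modules chained by import; credit docstring of record in the headline module
`Theorems/IR/Negative/TypShellCondFalseAllG.lean` (part 8/8).  Negative knowledge for stmt-QuantumFields-19354; closes no stub.
-/

set_option autoImplicit false

noncomputable section

open MeasureTheory Filter Topology
open Literature.MathematicalPhysics.QuantumLattice
open Literature.Probability.LatticeModels
open Summit.QuantumFields.YangMills.Cruxes.IR.Tempered (cellEdges windowCells regionEdges)
open Summit.QuantumFields.YangMills.Cruxes.IR.ShellTempered (windowCellsPlus)
open Summit.QuantumFields.YangMills.Cruxes.IR.OnsetFormats (TypShellCond shellCount)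
open Summit.QuantumFields.YangMills.Cruxes.IR.FixedMesh

namespace Summit.QuantumFields.YangMills.Cruxes.IR.FixedMeshAllG

/-! ## §7 The layer comb and the flatness of the twisted datum (PROVED) -/

section Comb

variable {G : Type} [Group G]

/-- `ℤ⁴` line holonomy: `zline ζ ν n y = ζ(y,ν) ζ(y+e_ν,ν) ⋯ ζ(y+(n-1)e_ν,ν)`. -/
def zline (ζ : LGConfig 4 G) (ν : Fin 4) : ℕ → Site 4 → G
  | 0, _ => 1
  | n + 1, y => ζ (y, ν) * zline ζ ν n (y + Pi.single ν 1)

/-- Workfile theorem `zline_zero` (cruxidea-2 g6, `CruxIdea2FrameRowAllG.lean` rev 2, re-homed verbatim;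
see the module docstring). -/
@[simp] theorem zline_zero (ζ : LGConfig 4 G) (ν : Fin 4) (y : Site 4) : zline ζ ν 0 y = 1 := rfl

/-- Workfile theorem `zline_succ` (cruxidea-2 g6, `CruxIdea2FrameRowAllG.lean` rev 2, re-homed verbatim;
see the module docstring). -/
theorem zline_succ (ζ : LGConfig 4 G) (ν : Fin 4) (n : ℕ) (y : Site 4) :
    zline ζ ν (n + 1) y = ζ (y, ν) * zline ζ ν n (y + Pi.single ν 1) := rfl

/-- Workfile theorem `single_add_nat` (cruxidea-2 g6, `CruxIdea2FrameRowAllG.lean` rev 2, re-homed verbatim;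
see the module docstring). -/
theorem single_add_nat (ν : Fin 4) (n : ℕ) :
    (Pi.single ν (1 : ℤ) : Site 4) + Pi.single ν (n : ℤ) = Pi.single ν ((n + 1 : ℕ) : ℤ) := by
  rw [← Pi.single_add]; congr 1; push_cast; ring

/-- Appending a link at the far end. -/
theorem zline_succ_right (ζ : LGConfig 4 G) (ν : Fin 4) : ∀ (n : ℕ) (y : Site 4),
    zline ζ ν (n + 1) y = zline ζ ν n y * ζ (y + Pi.single ν (n : ℤ), ν)
  | 0, y => by simp [zline]
  | n + 1, y => by
    rw [zline_succ, zline_succ_right ζ ν n (y + Pi.single ν 1), zline_succ, mul_assoc, add_assoc, single_add_nat]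

/-- Flatness of a `ℤ⁴` configuration (all plaquette holonomies trivial). -/
def FlatZd (ζ : LGConfig 4 G) : Prop := ∀ (y : Site 4) (i j : Fin 4), plaquetteHolonomyZd ζ y i j = 1

/-- Workfile theorem `mul_eq_mul_of_flatZd` (cruxidea-2 g6, `CruxIdea2FrameRowAllG.lean` rev 2, re-homed verbatim;
see the module docstring). -/
theorem mul_eq_mul_of_flatZd {ζ : LGConfig 4 G} (hζ : FlatZd ζ) (y : Site 4) (μ ν : Fin 4) :
    ζ (y, μ) * ζ (y + Pi.single μ 1, ν) = ζ (y, ν) * ζ (y + Pi.single ν 1, μ) := by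
  have h := hζ y μ ν
  rw [plaquetteHolonomyZd, mul_inv_eq_one, mul_inv_eq_iff_eq_mul] at h
  exact h

/-- **Sliding lemma on `ℤ⁴`.** -/
theorem mul_zline_eq_of_flatZd {ζ : LGConfig 4 G} (hζ : FlatZd ζ) (μ ν : Fin 4) :
    ∀ (n : ℕ) (y : Site 4), ζ (y, μ) * zline ζ ν n (y + Pi.single μ 1) =
      zline ζ ν n y * ζ (y + Pi.single ν (n : ℤ), μ)
  | 0, y => by simp
  | n + 1, y => by
    rw [zline_succ, zline_succ, ← mul_assoc, mul_eq_mul_of_flatZd hζ y μ ν, mul_assoc,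
      show y + Pi.single μ (1 : ℤ) + Pi.single ν 1 = y + Pi.single ν 1 + Pi.single μ 1 from add_right_comm _ _ _,
      mul_zline_eq_of_flatZd hζ μ ν n (y + Pi.single ν 1), mul_assoc, add_assoc, single_add_nat]

/-- The root of the comb: the layer-`(b+1)` site `(b+1, -R, -R, -R)`. -/
def combRoot (b R : ℕ) : Site 4 := fun i => if i = 0 then (b : ℤ) + 1 else -(R : ℤ)

/-- Number of steps of the comb path in direction `l`. -/
def combLen (R : ℕ) (x : Site 4) (l : Fin 4) : ℕ := (x l + R).toNat

/-- Start of the direction-2 segment. -/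
def combPt2 (b R : ℕ) (x : Site 4) : Site 4 := combRoot b R + Pi.single 1 (combLen R x 1 : ℤ)

/-- Start of the direction-3 segment. -/
def combPt3 (b R : ℕ) (x : Site 4) : Site 4 := combPt2 b R x + Pi.single 2 (combLen R x 2 : ℤ)

/-- The STAIRCASE transport of `ζ` from the root to (the layer point below/above) `x`: `n₁` steps in direction 1,
then `n₂` in direction 2, then `n₃` in direction 3, all inside the site layer `x 0 = b + 1`. Reads only the spatial
coordinates of `x` and only layer links. -/
def stair (b R : ℕ) (ζ : LGConfig 4 G) (x : Site 4) : G :=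
  zline ζ 1 (combLen R x 1) (combRoot b R) * zline ζ 2 (combLen R x 2) (combPt2 b R x) *
    zline ζ 3 (combLen R x 3) (combPt3 b R x)

/-- THE LAYER COMB `κ_{k₀}`: `κ ζ x = stair(x)⁻¹ · k₀ · stair(x)` — the constant `k₀` transported from the root along the
staircase (so `κ ζ (root) = k₀`, and `κ ζ` is covariantly constant along every staircase link BY CONSTRUCTION and along
every layer link when `ζ` is flat). -/
def comb (b R : ℕ) (k₀ : G) (ζ : LGConfig 4 G) (x : Site 4) : G := (stair b R ζ x)⁻¹ * k₀ * stair b R ζ x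

/-- The layer region over which the comb is coherent: height `b+1`, spatial coordinates `≥ -R`. -/
def InLayer (b R : ℕ) (x : Site 4) : Prop := x 0 = (b : ℤ) + 1 ∧ ∀ l : Fin 4, l ≠ 0 → -(R : ℤ) ≤ x l

/-- Workfile theorem `combPt3_add_eq` (cruxidea-2 g6, `CruxIdea2FrameRowAllG.lean` rev 2, re-homed verbatim;
see the module docstring). -/
theorem combPt3_add_eq {b R : ℕ} {x : Site 4} (hx : InLayer b R x) :
    combPt3 b R x + Pi.single 3 (combLen R x 3 : ℤ) = x := by
  funext i
  have h0 := hx.1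
  have h1 := hx.2 1 (by decide); have h2 := hx.2 2 (by decide); have h3 := hx.2 3 (by decide)
  simp only [combPt3, combPt2, combRoot, combLen, Pi.add_apply, Pi.single_apply]
  fin_cases i <;> simp <;> omega

/-- Workfile theorem `combLen_add_single_self` (cruxidea-2 g6, `CruxIdea2FrameRowAllG.lean` rev 2, re-homed verbatim;
see the module docstring). -/
theorem combLen_add_single_self {R : ℕ} {x : Site 4} {j : Fin 4} (hj : -(R : ℤ) ≤ x j) :
    combLen R (x + Pi.single j 1) j = combLen R x j + 1 := by
  simp only [combLen, Pi.add_apply, Pi.single_eq_same]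
  omega

/-- Workfile theorem `combLen_add_single_of_ne` (cruxidea-2 g6, `CruxIdea2FrameRowAllG.lean` rev 2, re-homed verbatim;
see the module docstring). -/
theorem combLen_add_single_of_ne {R : ℕ} (x : Site 4) {j l : Fin 4} (h : l ≠ j) :
    combLen R (x + Pi.single j 1) l = combLen R x l := by
  simp only [combLen, Pi.add_apply, Pi.single_eq_of_ne h, add_zero]

/-- Workfile theorem `inLayer_add_single` (cruxidea-2 g6, `CruxIdea2FrameRowAllG.lean` rev 2, re-homed verbatim;
see the module docstring). -/
theorem inLayer_add_single {b R : ℕ} {x : Site 4} (hx : InLayer b R x) {j : Fin 4} (hj : j ≠ 0) :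
    InLayer b R (x + Pi.single j 1) := by
  refine ⟨by rw [Pi.add_apply, Pi.single_eq_of_ne (Ne.symm hj) , add_zero]; exact hx.1, fun l hl => ?_⟩
  rw [Pi.add_apply, Pi.single_apply]
  have := hx.2 l hl
  split_ifs <;> omega

/-- Workfile theorem `single_natCast_succ` (cruxidea-2 g6, `CruxIdea2FrameRowAllG.lean` rev 2, re-homed verbatim;
see the module docstring). -/
theorem single_natCast_succ (ν : Fin 4) (n : ℕ) :
    (Pi.single ν ((n + 1 : ℕ) : ℤ) : Site 4) = Pi.single ν (n : ℤ) + Pi.single ν 1 := by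
  rw [← Pi.single_add]; push_cast; rfl

/-- Direction 3: pure extension of the last segment (no flatness). -/
theorem stair_add_single_three (ζ : LGConfig 4 G) {b R : ℕ} {x : Site 4} (hx : InLayer b R x) :
    stair b R ζ (x + Pi.single 3 1) = stair b R ζ x * ζ (x, 3) := by
  have hx3 := combPt3_add_eq hx
  have e1 : combLen R (x + Pi.single 3 1) 1 = combLen R x 1 := combLen_add_single_of_ne x (by decide)
  have e2 : combLen R (x + Pi.single 3 1) 2 = combLen R x 2 := combLen_add_single_of_ne x (by decide)
  have e3 : combLen R (x + Pi.single 3 1) 3 = combLen R x 3 + 1 := combLen_add_single_self (hx.2 3 (by decide))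
  have p2 : combPt2 b R (x + Pi.single 3 1) = combPt2 b R x := by simp only [combPt2, e1]
  have p3 : combPt3 b R (x + Pi.single 3 1) = combPt3 b R x := by simp only [combPt3, p2, e2]
  unfold stair
  rw [e1, e3, p2, p3, e2, zline_succ_right, hx3]
  group

/-- Direction 2: one slide across the last segment (flatness). -/
theorem stair_add_single_two {ζ : LGConfig 4 G} (hζ : FlatZd ζ) {b R : ℕ} {x : Site 4} (hx : InLayer b R x) :
    stair b R ζ (x + Pi.single 2 1) = stair b R ζ x * ζ (x, 2) := by
  have hx3 := combPt3_add_eq hx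
  have e1 : combLen R (x + Pi.single 2 1) 1 = combLen R x 1 := combLen_add_single_of_ne x (by decide)
  have e3 : combLen R (x + Pi.single 2 1) 3 = combLen R x 3 := combLen_add_single_of_ne x (by decide)
  have e2 : combLen R (x + Pi.single 2 1) 2 = combLen R x 2 + 1 := combLen_add_single_self (hx.2 2 (by decide))
  have p2 : combPt2 b R (x + Pi.single 2 1) = combPt2 b R x := by simp only [combPt2, e1]
  have p3 : combPt3 b R (x + Pi.single 2 1) = combPt3 b R x + Pi.single 2 1 := by
    simp only [combPt3, p2, e2, single_natCast_succ, add_assoc]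
  have s3 := mul_zline_eq_of_flatZd hζ 2 3 (combLen R x 3) (combPt3 b R x)
  rw [hx3] at s3
  have hp3 : combPt2 b R x + Pi.single 2 (combLen R x 2 : ℤ) = combPt3 b R x := rfl
  unfold stair
  rw [e1, e2, e3, p2, p3, zline_succ_right, hp3]
  calc zline ζ 1 (combLen R x 1) (combRoot b R) * (zline ζ 2 (combLen R x 2) (combPt2 b R x) * ζ (combPt3 b R x, 2)) *
        zline ζ 3 (combLen R x 3) (combPt3 b R x + Pi.single 2 1)
      = zline ζ 1 (combLen R x 1) (combRoot b R) * zline ζ 2 (combLen R x 2) (combPt2 b R x) *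
        (ζ (combPt3 b R x, 2) * zline ζ 3 (combLen R x 3) (combPt3 b R x + Pi.single 2 1)) := by group
    _ = _ := by rw [s3]; group

/-- Direction 1: two slides (flatness). -/
theorem stair_add_single_one {ζ : LGConfig 4 G} (hζ : FlatZd ζ) {b R : ℕ} {x : Site 4} (hx : InLayer b R x) :
    stair b R ζ (x + Pi.single 1 1) = stair b R ζ x * ζ (x, 1) := by
  have hx3 := combPt3_add_eq hx
  have e2 : combLen R (x + Pi.single 1 1) 2 = combLen R x 2 := combLen_add_single_of_ne x (by decide)
  have e3 : combLen R (x + Pi.single 1 1) 3 = combLen R x 3 := combLen_add_single_of_ne x (by decide)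
  have e1 : combLen R (x + Pi.single 1 1) 1 = combLen R x 1 + 1 := combLen_add_single_self (hx.2 1 (by decide))
  have p2 : combPt2 b R (x + Pi.single 1 1) = combPt2 b R x + Pi.single 1 1 := by
    simp only [combPt2, e1, single_natCast_succ, add_assoc]
  have p3 : combPt3 b R (x + Pi.single 1 1) = combPt3 b R x + Pi.single 1 1 := by
    simp only [combPt3, p2, e2]; rw [add_right_comm]
  have s2 := mul_zline_eq_of_flatZd hζ 1 2 (combLen R x 2) (combPt2 b R x)
  have s3 := mul_zline_eq_of_flatZd hζ 1 3 (combLen R x 3) (combPt3 b R x)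
  rw [hx3] at s3
  have hp2 : combRoot b R + Pi.single 1 (combLen R x 1 : ℤ) = combPt2 b R x := rfl
  have hp3 : combPt2 b R x + Pi.single 2 (combLen R x 2 : ℤ) = combPt3 b R x := rfl
  rw [hp3] at s2
  unfold stair
  rw [e1, e2, e3, p2, p3, zline_succ_right, hp2]
  calc zline ζ 1 (combLen R x 1) (combRoot b R) * ζ (combPt2 b R x, 1) *
        zline ζ 2 (combLen R x 2) (combPt2 b R x + Pi.single 1 1) *
        zline ζ 3 (combLen R x 3) (combPt3 b R x + Pi.single 1 1)
      = zline ζ 1 (combLen R x 1) (combRoot b R) * (ζ (combPt2 b R x, 1) *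
        zline ζ 2 (combLen R x 2) (combPt2 b R x + Pi.single 1 1)) *
        zline ζ 3 (combLen R x 3) (combPt3 b R x + Pi.single 1 1) := by group
    _ = zline ζ 1 (combLen R x 1) (combRoot b R) * zline ζ 2 (combLen R x 2) (combPt2 b R x) *
        (ζ (combPt3 b R x, 1) * zline ζ 3 (combLen R x 3) (combPt3 b R x + Pi.single 1 1)) := by
        rw [s2]; group
    _ = _ := by rw [s3]; group

/-- **Covariant constancy of the staircase along EVERY layer link, for flat `ζ` (PROVED; discrete Stokes).** -/
theorem stair_add_single_of_flatZd {ζ : LGConfig 4 G} (hζ : FlatZd ζ) {b R : ℕ} {x : Site 4} (hx : InLayer b R x)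
    {j : Fin 4} (hj : j ≠ 0) : stair b R ζ (x + Pi.single j 1) = stair b R ζ x * ζ (x, j) := by
  have : j = 1 ∨ j = 2 ∨ j = 3 := by
    fin_cases j
    · exact absurd rfl hj
    · exact Or.inl rfl
    · exact Or.inr (Or.inl rfl)
    · exact Or.inr (Or.inr rfl)
  rcases this with rfl | rfl | rfl
  · exact stair_add_single_one hζ hx
  · exact stair_add_single_two hζ hx
  · exact stair_add_single_three ζ hx

/-- Covariant constancy of a site function `k` along the layer links over the region `InLayer b R`. -/
def LayerCov (b R : ℕ) (ζ : LGConfig 4 G) (k : Site 4 → G) : Prop :=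
  ∀ x : Site 4, InLayer b R x → ∀ j : Fin 4, j ≠ 0 → k (x + Pi.single j 1) = (ζ (x, j))⁻¹ * k x * ζ (x, j)

/-- **PROVED.** For flat `ζ` the comb is covariantly constant along every layer link of the region. -/
theorem layerCov_comb {ζ : LGConfig 4 G} (hζ : FlatZd ζ) (b R : ℕ) (k₀ : G) : LayerCov b R ζ (comb b R k₀ ζ) := by
  intro x hx j hj
  simp only [comb, stair_add_single_of_flatZd hζ hx hj, mul_inv_rev]
  group

/-- **PROVED (the twisted datum is flat).** If `ζ` is flat and `k` is covariantly constant along the layer links of the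
region, then `topTwist b k ζ` is flat at every plaquette based at a site with spatial coordinates `≥ -R`. -/
theorem flat_topTwist {ζ : LGConfig 4 G} (hζ : FlatZd ζ) {b R : ℕ} {k : Site 4 → G} (hk : LayerCov b R ζ k)
    {y : Site 4} (hy : ∀ l : Fin 4, l ≠ 0 → -(R : ℤ) ≤ y l) {i j : Fin 4} (hij : i < j) :
    plaquetteHolonomyZd (topTwist b k ζ) y i j = 1 := by
  have hj0 : j ≠ 0 := fun h => by rw [h] at hij; exact (Fin.not_lt_zero _ hij).elim
  have hyi : ((y + Pi.single i (1 : ℤ) : Site 4)) 0 = y 0 + if i = 0 then 1 else 0 := add_single_apply_zero y i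
  have hyj : ((y + Pi.single j (1 : ℤ) : Site 4)) 0 = y 0 := by rw [add_single_apply_zero, if_neg hj0, add_zero]
  rcases lt_trichotomy (y 0) (b : ℤ) with hlt | heq | hgt
  · -- all four edges based at height ≤ b : the twist is a gauge transformation there
    have hA : ∀ e : ZdEdge 4, e.1 0 ≤ (b : ℤ) → topTwist b k ζ e = gaugeTransformZd (layerGauge b k) ζ e :=
      fun e he => (gaugeTransformZd_layerGauge_apply k ζ he).symm
    have : plaquetteHolonomyZd (topTwist b k ζ) y i j = plaquetteHolonomyZd (gaugeTransformZd (layerGauge b k) ζ) y i j := by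
      unfold plaquetteHolonomyZd
      rw [hA (y, i) (by simp only; omega), hA (y + Pi.single i 1, j) (by simp only [hyi]; split_ifs <;> omega),
        hA (y + Pi.single j 1, i) (by simp only [hyj]; omega), hA (y, j) (by simp only; omega)]
    rw [this, plaquetteHolonomyZd_gaugeTransformZd, hζ y i j, mul_one, mul_inv_cancel]
  · by_cases hi0 : i = 0
    · -- the mixed temporal plaquette: covariant constancy of `k` along the layer link `(y + e₀, j)`
      subst hi0
      set x : Site 4 := y + Pi.single 0 1 with hxdef
      have hxL : InLayer b R x := ⟨by rw [hyi, if_pos rfl, heq], fun l hl => by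
        rw [hxdef, Pi.add_apply, Pi.single_eq_of_ne hl, add_zero]; exact hy l hl⟩
      have hcov := hk x hxL j hj0
      have e1 : topTwist b k ζ (y, 0) = ζ (y, 0) * (k x)⁻¹ := by unfold topTwist; rw [if_pos ⟨rfl, heq⟩]
      have e2 : topTwist b k ζ (x, j) = ζ (x, j) :=
        topTwist_apply_of_ne k ζ (by show x 0 ≠ _; rw [hxL.1]; omega)
      have e3 : topTwist b k ζ (y + Pi.single j 1, 0) = ζ (y + Pi.single j 1, 0) * (k (x + Pi.single j 1))⁻¹ := by
        unfold topTwist; rw [if_pos ⟨rfl, by show ((y + Pi.single j (1:ℤ) : Site 4)) 0 = _; rw [hyj, heq]⟩]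
        simp only [hxdef, add_right_comm y (Pi.single j 1) (Pi.single 0 1)]
      have e4 : topTwist b k ζ (y, j) = ζ (y, j) := by unfold topTwist; rw [if_neg (fun h => hj0 h.1)]
      have hflat := mul_eq_mul_of_flatZd hζ y 0 j
      rw [← hxdef] at hflat
      unfold plaquetteHolonomyZd
      rw [← hxdef, e1, e2, e3, e4, hcov]
      calc ζ (y, 0) * (k x)⁻¹ * ζ (x, j) * (ζ (y + Pi.single j 1, 0) * ((ζ (x, j))⁻¹ * k x * ζ (x, j))⁻¹)⁻¹ * (ζ (y, j))⁻¹
          = (ζ (y, 0) * ζ (x, j)) * (ζ (y + Pi.single j 1, 0))⁻¹ * (ζ (y, j))⁻¹ := by group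
        _ = 1 := by rw [hflat]; group
    · -- `y 0 = b`, both directions spatial: all four edges at height `b`
      have hA : ∀ e : ZdEdge 4, e.1 0 ≤ (b : ℤ) → topTwist b k ζ e = gaugeTransformZd (layerGauge b k) ζ e :=
        fun e he => (gaugeTransformZd_layerGauge_apply k ζ he).symm
      have : plaquetteHolonomyZd (topTwist b k ζ) y i j = plaquetteHolonomyZd (gaugeTransformZd (layerGauge b k) ζ) y i j := by
        unfold plaquetteHolonomyZd
        rw [hA (y, i) (by simp only; omega), hA (y + Pi.single i 1, j) (by simp only [hyi, if_neg hi0]; omega),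
          hA (y + Pi.single j 1, i) (by simp only [hyj]; omega), hA (y, j) (by simp only; omega)]
      rw [this, plaquetteHolonomyZd_gaugeTransformZd, hζ y i j, mul_one, mul_inv_cancel]
  · -- all four edges based at height ≥ b + 1 : the twist is the identity there
    have hB : ∀ e : ZdEdge 4, (b : ℤ) < e.1 0 → topTwist b k ζ e = ζ e := fun e he =>
      topTwist_apply_of_ne k ζ (ne_of_gt he)
    unfold plaquetteHolonomyZd
    rw [hB (y, i) (by simp only; omega), hB (y + Pi.single i 1, j) (by simp only [hyi]; split_ifs <;> omega),
      hB (y + Pi.single j 1, i) (by simp only [hyj]; omega), hB (y, j) (by simp only; omega)]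
    have := hζ y i j
    unfold plaquetteHolonomyZd at this
    exact this

end Comb

end Summit.QuantumFields.YangMills.Cruxes.IR.FixedMeshAllG

end
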